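import Summits.CriticalPhenomena.PercolationContinuityZ3.Theorems.PercNearOneGluingNoHeavyQuantHeavySingleTools
import Summits.CriticalPhenomena.PercolationContinuityZ3.Theorems.PercNearOneGluingNoHeavyQuantThreeRootHeavySingleOracle
import Summits.CriticalPhenomena.PercolationContinuityZ3.Theorems.PercNearOneGluingNoHeavyQuantGateMoveBlobCells
import HarnessLib

/-!
# QUANT lane R8, T-DEC: THE HEAVY-SINGLE BALANCED SIBLING STEP, EVERY WIDTH — a sibling whose root gate carries the compound's whole
# gated mean against each sibling's opened mean (`fmean L ≤ q₁·mean ρ_t` for all `t`) makes the forest `s :: L` SDEC at its TRUE floor,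
# GIVEN the `GateStepN` oracle: the law-level assembly of the U-RPM (arm-1 gen 53, architect)

builds on p205010 (kernel theorem, internal audit signed; external expert review pending)

Support file (`--supports stmt-CriticalPhenomena-4575`), QUANT lane seat prim-quant-arm-1 (gen 53, architect), rung R8 of
`run/shared/lean/prim/quant/LADDER.md`; memo `run/shared/lean/prim/quant/prim-quant-arm-1-g53/ARCH-G53.md`.  Theorems only, standard axioms, no
sorries.  STEP (C) of the U-RPM chain: (A)+(B) are census-1 g25's ✓ `…QuantURPMIdentity` (closed-form weights `urpmW`, `urpm_total`, `urpmW_nonneg`),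
✓ `…QuantURPMLift`, ✓ `…QuantURPMLaw` (`upart_rootPattern_mixture`: the opened compound `H = (flaw L − (1−q₁)δ₀)/q₁` IS the `urpmW`-mixture of the
re-gated sub-forests `subRegate L E (openE L q₁ E)`, every width; `openE_le_one`, `lrel_le_openE`); the width-3 case is arm-1 g52's
✓ `…QuantThreeRootHeavySingleStep/Oracle` (five components); the setting is ARCH-G52 §3 (the U-term root-pattern mixture).

THE THEOREM (`decAt_gate_flaw_heavySingle_of_oracle`, **`sdec_flaw_heavySingle_of_oracle`**).  Floor `0 < x < 1`; a tree-built sibling `s`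
(`Sib.TreeOK x`: root gate `q₁ = s.q`, opened sub-forest `s.ρ` tree-built at `s.x₁` with `s.n` gates) in front of a NON-EMPTY list `L` of tree-built
siblings; the ORACLE "every `TreeBuiltN` law with fewer than `fgates (s :: L)` nontrivial gates is SDEC at its floor" (the induction hypothesis of
`SiblingStep` / `GateStepN`); and the BALANCE condition `fmean L ≤ q₁ · mean ρ_t` for every `t ∈ L` (the compound's gated mean over `q₁` — the common
mean `m*` of the U-RPM components — is at most every sibling's opened mean; it implies the heavy-single orientation `fQ L ≤ Σ q_t ≤ q₁`).  THEN
`flaw (s :: L)` is SDEC at `x` — the list form of the sibling step (`siblingStep_iff_list`) ON THIS FAMILY, ANY WIDTH, AT THE TRUE FLOOR.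
PROOF.  `flaw L = gate Hmix q₁` with `Hmix = Σ_{E≠∅} w_E · flaw (L|_E^{o^E})` (`upart_rootPattern_mixture`), so `s :: L` is a two-root forest with EQUAL
root gates `(q₁, q₁)`; arm-1 g45's `twoRoot_gateCoupling` splits `gate_a(flaw (s :: L))` into `w·[gate_{aq₁} s.ρ ∗ gate_a (flaw L)]` (`w = (1−q₁)/(1−aq₁)`;
two oracle calls — `s.ρ` and the compound `flaw L`, `fgates L < fgates (s :: L)` — glued by `convClosedT_holds`) and `(1−w)·gate_{aq₁}(s.ρ ∗ Hmix) =
(1−w)·Σ_E w_E · gate_{aq₁}(s.ρ ∗ flaw (L|_E^{o^E}))`: each component is ONE oracle call — the opened single beside the sub-forest `E` re-gated to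
openness `o^E_i = (q_i/q₁)/s_E ∈ [q_i/q₁, 1]` is tree-built at the UNIFORM floor `x/q₁` (`o^E_i·x₁ᵢ ≥ (q_i/q₁)x₁ᵢ ≥ x/q₁`, `s.x₁ ≥ x/q₁`) with at most
`s.n + fgates L < fgates (s :: L)` gates (`treeBuiltN_flaw_weak`, gates `≤ 1` allowed via `treeBuiltN_gate_le`) — and has gated mean EXACTLY the common target
`a·(q₁·mean s.ρ + fmean L)` (`fmean_subRegate_openE`: every component has opened mean `mean s.ρ + fmean L/q₁`); `decAtT_mixture_finset` along
`urpm_total`/`urpmW_nonneg`, then `decAtT_mixture`.  No slack anywhere: the floor is the forest's own.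
ALSO: `sdec_flaw_of_heavyMember` (the balanced heavy sibling anywhere in the list, via `flaw_perm` / `ftop_perm` / `fgates_perm`).  Bookkeeping
(`ftop/fgates/fmean_subRegate`, `fmean_subRegate_openE`, `flaw_facts_weak`, `treeBuiltN_flaw_weak`, `gate_fsum_mix`, `fQ_le_of_balance`) is in
`…QuantHeavySingleTools`.

HONEST STATUS.  A k-general SUB-FAMILY of the open core (`SiblingStep` ⟺ `GateStepN`): the complement orientations (arm-1 g46 generic `q₃ ≤ Q`, g47's
compound cut / `UPartStep` with the LEAST gate as single, unbalanced heavy singles where the U-law is NOT a mixture of oracle-legal products — ARCH-G52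
§3.2 exact-LP dichotomy) remain OPEN, as do `LightResidDECOracle`, `SiblingStep`, `GateStepN`, `FarTreeRow`; RATE class (log\*) and the honest sentence of
`run/shared/lean/prim/quant/README.md` unchanged.  [this work]; U-RPM identity and law-level lift: prim-quant-census-1 g25; two-root identity: prim-quant-arm-1
g45; list binder: prim-quant-stmt g39; compound cut pattern: prim-quant-arm-1 g47.  Nothing here is cited as a published result.  The gluing rows served
[cite: KozmaNitzan2024, Conjecture 3 (p. 15)]; product measure [cite: Grimmett1999, §1.3 p. 10].
-/

noncomputable section

open scoped BigOperators

namespace Summit.CriticalPhenomena.PercolationContinuityZ3.Theorems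
namespace Quant
namespace LawDec

open Finset URPM

/-! ### The heavy-single balanced sibling step -/

/-- **THE HEAVY-SINGLE BALANCED SIBLING STEP, EVERY WIDTH (DEC form with an outer gate).**  See the module docstring: under the oracle below
`fgates (s :: L)` and the balance condition `fmean L ≤ s.q · mean ρ_t` (`t ∈ L`), the gated forest `gate (flaw (s :: L)) a` is DEC at floor `a·x`
at every layer `j < ftop (s :: L)`, for every outer gate `0 < a ≤ 1`. [this work] -/
theorem decAt_gate_flaw_heavySingle_of_oracle {x a : ℝ} (hx0 : 0 < x) (hx1 : x < 1) (s : Sib) (L : List Sib)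
    (hs : s.TreeOK x) (hL : ∀ t ∈ L, t.TreeOK x) (hne : L ≠ [])
    (hO : ∀ (x' : ℝ) (n' M' : ℕ) (μ' : ℕ → ℝ), n' < fgates (s :: L) → TreeBuiltN x' n' M' μ' → SDEC x' M' μ')
    (hbal : ∀ t ∈ L, fmean L ≤ s.q * t.mean) (ha0 : 0 < a) (ha1 : a ≤ 1) :
    ∀ j, j < ftop (s :: L) → DECAt (a * x) j (ftop (s :: L)) (gate (flaw (s :: L)) a) := by
  classical
  intro j hj
  -- data of the single
  obtain ⟨hq0, hq1, hxq, hT, _⟩ := hs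
  obtain ⟨hx₁0, hx₁1, ρ0, ρM, ρ1, ρta⟩ := hT.lawFacts
  set q₁ : ℝ := s.q with hq₁def
  have hL' : ∀ t ∈ L, t.LawOK := fun t ht => (hL t ht).lawOK
  have hsL : ∀ t ∈ s :: L, t.LawOK := by
    intro t ht
    rcases List.mem_cons.1 ht with rfl | ht
    · exact ⟨hq0, hq1, ρ0, ρM, ρ1⟩
    · exact hL' t ht
  -- positional data of the compound
  have hget : ∀ i : Fin L.length, (L.get i).TreeOK x := fun i => hL _ (List.get_mem L i)
  have hqpos : ∀ i : Fin L.length, 0 < (L.get i).q := fun i => (hget i).1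
  have hmpos : ∀ i : Fin L.length, 0 < (L.get i).mean := fun i => (L.get i).mean_pos (hget i)
  have hbal' : ∀ i : Fin L.length, fmean L ≤ q₁ * (L.get i).mean := fun i => hbal _ (List.get_mem L i)
  have hk : 0 < L.length := List.length_pos_of_ne_nil hne
  have hR : (Finset.univ : Finset (Fin L.length)).Nonempty := Finset.univ_nonempty_iff.2 ⟨⟨0, hk⟩⟩
  have hpos : ∀ i : Fin L.length, 0 < (L.get i).q * (L.get i).mean := fun i => mul_pos (hqpos i) (hmpos i)
  have hfm : 0 < fmean L := by
    rw [fmean_eq_sum_get]; exact Finset.sum_pos (fun i _ => hpos i) hR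
  have hc : asum (share L) Finset.univ = 1 := asum_share_univ L (ne_of_gt hfm)
  have hcpos : ∀ t, 0 < share L t := fun t => div_pos (hpos t) hfm
  -- elementary bounds
  have haq0 : 0 < a * q₁ := mul_pos ha0 hq0
  have haq1 : a * q₁ < 1 := mul_lt_one_aux ha1 hq0.le hq1
  have hxq₁ : x < q₁ := lt_of_le_of_lt hxq (by nlinarith)
  set z : ℝ := a * x with hzdef
  have hz0 : 0 < z := mul_pos ha0 hx0
  have hz1 : z < 1 := by rw [hzdef]; nlinarith
  -- the uniform floor of the components
  set v : ℝ := x / q₁ with hvdef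
  have hv0 : 0 < v := div_pos hx0 hq0
  have hv1 : v < 1 := by rw [hvdef, div_lt_one hq0]; exact hxq₁
  have hvx₁ : v ≤ s.x₁ := by rw [hvdef, div_le_iff₀ hq0, mul_comm]; exact hxq
  have hzv : z = a * q₁ * v := by rw [hzdef, hvdef]; field_simp
  -- the common target
  set TE : ℝ := a * (q₁ * s.mean + fmean L) with hTEdef
  -- the mixture law of the U-RPM components and the weights
  set Pp : Finset (Finset (Fin L.length)) := (Finset.univ : Finset (Fin L.length)).powerset.erase ∅ with hPp
  set w : Finset (Fin L.length) → ℝ := fun E => urpmW q₁ (share L) Finset.univ E with hwdef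
  set cmp : Finset (Fin L.length) → List Sib := fun E => subRegate L E (openE L q₁ E) with hcmpdef
  set Hmix : ℕ → ℝ := fun k => ∑ E ∈ Pp, w E * flaw (cmp E) k with hHmixdef
  have hw0 : ∀ E ∈ Pp, 0 ≤ w E := by
    intro E _
    have hs0 : 0 ≤ asum (share L) E := Finset.sum_nonneg fun t _ => (hcpos t).le
    have hs1 : asum (share L) E ≤ 1 := by
      rw [← hc]; exact Finset.sum_le_sum_of_subset_of_nonneg (Finset.subset_univ E) fun t _ _ => (hcpos t).le
    refine urpmW_nonneg q₁ (share L) Finset.univ E hq0.le hq1.le hs0 ?_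
    calc q₁ * asum (share L) E ≤ 1 * 1 := mul_le_mul hq1.le hs1 hs0 zero_le_one
      _ = 1 := one_mul 1
  have hw1 : ∑ E ∈ Pp, w E = 1 := urpm_total q₁ (share L) Finset.univ hR hc hq0.ne'
  -- the compound IS the mixture gated by `q₁`
  have eHm : flaw L = gate Hmix q₁ := by
    funext h
    have key := upart_rootPattern_mixture L q₁ hq0.ne' hne hqpos hmpos h
    rw [gate_apply]
    have : q₁ * Hmix h = flaw L h - (1 - q₁) * (if h = 0 then 1 else 0) := key
    split_ifs with h0
    · rw [h0] at this ⊢; simp only [if_true, mul_one] at this; linarith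
    · rw [if_neg h0, mul_zero, sub_zero] at this; linarith
  -- the components: membership, tops, vanishing
  have hmem : ∀ E t, t ∈ cmp E → ∃ i ∈ E, t = regate (L.get i) (openE L q₁ E i) := fun E t ht => (mem_subRegate L E _ t).1 ht
  have htopE : ∀ E, ftop (cmp E) ≤ ftop L := fun E => ftop_subRegate_le L E _
  have hgatesE : ∀ E, fgates (cmp E) ≤ fgates L := fun E => fgates_subRegate_le L E _
  have HmixM : ∀ h, ftop L < h → Hmix h = 0 := by
    intro h hh
    exact Finset.sum_eq_zero fun E _ => by rw [flaw_eq_zero_of_lt (cmp E) h (lt_of_le_of_lt (htopE E) hh), mul_zero]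
  -- ORACLE CALLS.  (1) the opened single
  have hS₁ : SDEC s.x₁ s.M s.ρ := hO s.x₁ s.n s.M s.ρ (by simp only [fgates]; omega) hT
  -- (2) the compound forest
  have hF : TreeBuiltN x (fgates L) (ftop L) (flaw L) := flaw_treeBuiltN hx0 hx1 L hL
  have hSL : SDEC x (ftop L) (flaw L) := hO x (fgates L) (ftop L) (flaw L) (by simp only [fgates]; omega) hF
  obtain ⟨f0, fM, f1, fmn⟩ := flaw_facts L hL'
  obtain ⟨_, _, _, _, _, fta⟩ := hF.lawFacts
  -- term P: `gate_{a q₁} s.ρ ∗ gate_a (flaw L)` — ConvClosedT on two gated SDEC laws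
  obtain ⟨g₁0, g₁M, g₁1⟩ := gate_laws s.M s.ρ (a * q₁) haq0.le haq1.le ρ0 ρM ρ1
  obtain ⟨g₂0, g₂M, g₂1⟩ := gate_laws (ftop L) (flaw L) a ha0.le ha1 f0 fM f1
  have hP : DECAtT z TE j (s.M + ftop L) (lconv s.M (ftop L) (gate s.ρ (a * q₁)) (gate Hmix (a * q₁))) := by
    have eG : gate Hmix (a * q₁) = gate (flaw L) a := by rw [eHm, gate_gate]
    rw [eG]
    have d₁ : ∀ j'', DECAtT z (a * q₁ * s.mean) j'' s.M (gate s.ρ (a * q₁)) := by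
      intro j''
      exact decAtT_gate_of_sdec s.M s.ρ s.x₁ (a * q₁) z hx₁0.le haq0 haq1.le (mul_lt_one_aux haq1.le hx₁0.le hx₁1)
        (by rw [hzv]; exact mul_le_mul_of_nonneg_left hvx₁ haq0.le) ρ0 ρM ρ1 ρta hS₁ j''
    have d₂ : ∀ j'', DECAtT z (a * fmean L) j'' (ftop L) (gate (flaw L) a) := by
      intro j''
      have := decAtT_gate_of_sdec (ftop L) (flaw L) x a z hx0.le ha0 ha1 (mul_lt_one_aux ha1 hx0.le hx1) le_rfl f0 fM f1
        fta hSL j''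
      rwa [fmn] at this
    have hjj : j < s.M + ftop L := by simp only [ftop] at hj; omega
    have hC := convClosedT_holds z (a * q₁ * s.mean) (a * fmean L) s.M (ftop L) j _ _ hz0 hz1 g₁0 g₁M g₁1 g₂0 g₂M g₂1 hjj
      (fun k _ _ => d₁ k) (fun k _ _ => d₂ k)
    have e : a * q₁ * s.mean + a * fmean L = TE := by rw [hTEdef]; ring
    rwa [e] at hC
  -- term U: the mixture of the components, each ONE oracle call at the uniform floor `v`
  have hUE : ∀ E ∈ Pp, 0 < w E → DECAtT z TE j (s.M + ftop L) (gate (lconv s.M (ftop L) s.ρ (flaw (cmp E))) (a * q₁)) := by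
    intro E hE _
    have hEne : E.Nonempty := Finset.nonempty_iff_ne_empty.2 (Finset.ne_of_mem_erase hE)
    -- members of the component: gates in `(0,1]`, tree-built sub-forests, floor `v`
    have hK : ∀ t ∈ cmp E, 0 < t.q ∧ t.q ≤ 1 ∧ TreeBuiltN t.x₁ t.n t.M t.ρ ∧ v ≤ t.q * t.x₁ := by
      intro t ht
      obtain ⟨i, hi, rfl⟩ := hmem E t ht
      obtain ⟨iq0, _, ixq, iT, _⟩ := hget i
      obtain ⟨ix₁0, _, _, _, _, _⟩ := iT.lawFacts
      have ho1 : openE L q₁ E i ≤ 1 := openE_le_one L q₁ hq0 hqpos hmpos hbal' E hi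
      have hol : lrel L q₁ i ≤ openE L q₁ E i := lrel_le_openE L q₁ hq0 hqpos hmpos E hi
      have hl0 : 0 < lrel L q₁ i := div_pos iq0 hq0
      refine ⟨lt_of_lt_of_le hl0 hol, ho1, iT, ?_⟩
      show v ≤ openE L q₁ E i * (L.get i).x₁
      calc v = x / q₁ := hvdef
        _ ≤ (L.get i).q * (L.get i).x₁ / q₁ := by rw [div_le_div_iff_of_pos_right hq0]; exact ixq
        _ = lrel L q₁ i * (L.get i).x₁ := by unfold lrel; ring
        _ ≤ openE L q₁ E i * (L.get i).x₁ := mul_le_mul_of_nonneg_right hol ix₁0.le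
    have hKlaw : ∀ t ∈ cmp E, 0 ≤ t.q ∧ t.q ≤ 1 ∧ (∀ h, 0 ≤ t.ρ h) ∧ (∀ h, t.M < h → t.ρ h = 0) ∧
        ∑ h ∈ Finset.range (t.M + 1), t.ρ h = 1 := by
      intro t ht
      obtain ⟨tq0, tq1, tT, _⟩ := hK t ht
      obtain ⟨_, _, t0, tM, t1, _⟩ := tT.lawFacts
      exact ⟨tq0.le, tq1, t0, tM, t1⟩
    obtain ⟨nE, hnE, hTE⟩ := treeBuiltN_flaw_weak hv0 hv1 (cmp E) hK
    obtain ⟨c0, cM, c1, cmn⟩ := flaw_facts_weak (cmp E) hKlaw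
    -- the component forest: the opened single beside the re-gated sub-forest, at floor `v`, fewer than `fgates (s :: L)` gates
    have hsv : TreeBuiltN v s.n s.M s.ρ := TreeBuiltN.mono hT hv0 hvx₁
    have hconv : TreeBuiltN v (s.n + nE) (s.M + ftop (cmp E)) (lconv s.M (ftop (cmp E)) s.ρ (flaw (cmp E))) :=
      TreeBuiltN.conv hsv hTE
    have hSE : SDEC v (s.M + ftop (cmp E)) (lconv s.M (ftop (cmp E)) s.ρ (flaw (cmp E))) :=
      hO v (s.n + nE) _ _ (by have := hgatesE E; simp only [fgates]; omega) hconv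
    obtain ⟨_, _, F0, FM, F1, Fta⟩ := hconv.lawFacts
    have hmeanE : ∑ h ∈ Finset.range (s.M + ftop (cmp E) + 1), (h : ℝ) * lconv s.M (ftop (cmp E)) s.ρ (flaw (cmp E)) h
        = s.mean + fmean L / q₁ := by
      rw [sum_mul_lconv _ _ _ _ ρ1 c1, cmn, hcmpdef]
      simp only
      rw [fmean_subRegate_openE L q₁ hq0.ne' hqpos hmpos E hEne]
      rfl
    have d := decAtT_gate_of_sdec (s.M + ftop (cmp E)) _ v (a * q₁) z hv0.le haq0 haq1.le (mul_lt_one_aux haq1.le hv0.le hv1)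
      (le_of_eq hzv) F0 FM F1 Fta hSE j
    rw [hmeanE] at d
    have eT : a * q₁ * (s.mean + fmean L / q₁) = TE := by rw [hTEdef]; field_simp
    rw [eT] at d
    -- raise the right top from `ftop (cmp E)` to `ftop L`
    have eF : gate (lconv s.M (ftop L) s.ρ (flaw (cmp E))) (a * q₁) = gate (lconv s.M (ftop (cmp E)) s.ρ (flaw (cmp E))) (a * q₁) := by
      have : lconv s.M (ftop L) s.ρ (flaw (cmp E)) = lconv s.M (ftop (cmp E)) s.ρ (flaw (cmp E)) :=
        funext fun h => lconv_top_right_of_le s.M (ftop (cmp E)) (ftop L) s.ρ (flaw (cmp E)) (htopE E) (flaw_eq_zero_of_lt (cmp E)) h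
      rw [this]
    rw [eF]
    exact decAtT_mono_top d (by have := htopE E; omega)
  have hU : DECAtT z TE j (s.M + ftop L) (gate (lconv s.M (ftop L) s.ρ (gate Hmix (q₁ / q₁))) (a * q₁)) := by
    rw [div_self hq0.ne', gate_one]
    have e : gate (lconv s.M (ftop L) s.ρ Hmix) (a * q₁)
        = fun h => ∑ E ∈ Pp, w E * gate (lconv s.M (ftop L) s.ρ (flaw (cmp E))) (a * q₁) h := by
      funext h
      have e1 : lconv s.M (ftop L) s.ρ Hmix = fun k => ∑ E ∈ Pp, w E * lconv s.M (ftop L) s.ρ (flaw (cmp E)) k :=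
        funext fun k => lconv_fsum_right Pp s.M (ftop L) w s.ρ (fun E => flaw (cmp E)) k
      rw [e1, gate_fsum_mix Pp w _ (a * q₁) hw1 h]
    rw [e]
    exact decAtT_mixture_finset Pp w _ hw0 hw1 hUE
  -- the two-root split with equal root gates `(q₁, q₁)` and the mixture
  set w₀ : ℝ := (1 - q₁) / (1 - a * q₁) with hw₀def
  have hw₀0 : 0 ≤ w₀ := div_nonneg (by linarith) (by linarith)
  have hw₀1 : w₀ ≤ 1 := by
    rw [hw₀def, div_le_one (by linarith)]
    have : a * q₁ ≤ 1 * q₁ := mul_le_mul_of_nonneg_right ha1 hq0.le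
    linarith
  have mix := decAtT_mixture w₀ hw₀0 hw₀1 hP hU
  have e : gate (flaw (s :: L)) a
      = fun h => w₀ * lconv s.M (ftop L) (gate s.ρ (a * q₁)) (gate Hmix (a * q₁)) h
          + (1 - w₀) * gate (lconv s.M (ftop L) s.ρ (gate Hmix (q₁ / q₁))) (a * q₁) h := by
    funext h
    have eF : flaw (s :: L) = lconv s.M (ftop L) (gate s.ρ q₁) (gate Hmix q₁) := by
      show lconv (ftop L) s.M (flaw L) (gate s.ρ s.q) = _
      rw [lconv_comm, eHm]
    rw [eF, hw₀def]
    exact twoRoot_gateCoupling s.M (ftop L) s.ρ Hmix q₁ q₁ a ρM HmixM hq0.ne' (by linarith) h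
  -- the mean of the gated forest
  obtain ⟨_, _, _, tmn⟩ := flaw_facts (s :: L) hsL
  have htop : ftop (s :: L) = s.M + ftop L := by simp only [ftop]; omega
  have hEmean : ∑ h ∈ Finset.range (ftop (s :: L) + 1), (h : ℝ) * gate (flaw (s :: L)) a h = TE := by
    rw [sum_mul_gate, tmn, hTEdef]
    simp only [fmean]
    ring
  rw [decAt_iff_decAtT, hEmean, e, htop]
  exact mix

/-- **THE HEAVY-SINGLE BALANCED SIBLING STEP, EVERY WIDTH (SDEC form).**  For a floor `0 < x < 1`, a tree-built sibling `s` in front of a non-empty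
list `L` of tree-built siblings (`Sib.TreeOK x`), GIVEN the oracle "every tree-built law with fewer than `fgates (s :: L)` nontrivial gates is SDEC"
(the induction hypothesis of `SiblingStep`), IF `fmean L ≤ s.q · mean ρ_t` for every `t ∈ L` (balance; it implies the heavy-single orientation
`fQ L ≤ s.q`), THEN `SDEC x (ftop (s :: L)) (flaw (s :: L))` — the list form of the sibling step on this family, at the forest's true floor. [this work] -/
theorem sdec_flaw_heavySingle_of_oracle {x : ℝ} (hx0 : 0 < x) (hx1 : x < 1) (s : Sib) (L : List Sib)
    (hs : s.TreeOK x) (hL : ∀ t ∈ L, t.TreeOK x) (hne : L ≠ [])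
    (hO : ∀ (x' : ℝ) (n' M' : ℕ) (μ' : ℕ → ℝ), n' < fgates (s :: L) → TreeBuiltN x' n' M' μ' → SDEC x' M' μ')
    (hbal : ∀ t ∈ L, fmean L ≤ s.q * t.mean) :
    SDEC x (ftop (s :: L)) (flaw (s :: L)) := by
  intro a ha0 ha1 j hj
  exact decAt_gate_flaw_heavySingle_of_oracle hx0 hx1 s L hs hL hne hO hbal ha0 ha1 j hj

/-! ### Corollaries: the balanced heavy sibling anywhere in the list; balance implies the heavy-single orientation -/

/-- **the balanced heavy sibling may sit anywhere in the list** (the forest law, its top and its gate count are permutation invariant: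
`flaw_perm`, `ftop_perm`, `fgates_perm`). [this work] -/
theorem sdec_flaw_of_heavyMember {x : ℝ} (hx0 : 0 < x) (hx1 : x < 1) (L : List Sib) (s : Sib) (L₀ : List Sib)
    (hp : L.Perm (s :: L₀)) (hL : ∀ t ∈ L, t.TreeOK x) (hne : L₀ ≠ [])
    (hO : ∀ (x' : ℝ) (n' M' : ℕ) (μ' : ℕ → ℝ), n' < fgates L → TreeBuiltN x' n' M' μ' → SDEC x' M' μ')
    (hbal : ∀ t ∈ L₀, fmean L₀ ≤ s.q * t.mean) : SDEC x (ftop L) (flaw L) := by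
  have hs : s.TreeOK x := hL s (hp.mem_iff.2 List.mem_cons_self)
  have hL₀ : ∀ t ∈ L₀, t.TreeOK x := fun t ht => hL t (hp.mem_iff.2 (List.mem_cons_of_mem s ht))
  have hfg : fgates L = fgates (s :: L₀) := fgates_perm hp
  rw [flaw_perm hp, ftop_perm hp]
  exact sdec_flaw_heavySingle_of_oracle hx0 hx1 s L₀ hs hL₀ hne (fun x' n' M' μ' hn => hO x' n' M' μ' (by rw [hfg]; exact hn)) hbal

end LawDec
end Quant
end Summit.CriticalPhenomena.PercolationContinuityZ3.Theorems
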